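import Literature.Analysis.UnboundedOperators.HeatKernelPoincare
import Literature.Analysis.UnboundedOperators.HeatFlowCalculus
import Literature.Analysis.UnboundedOperators.HeatExtensionUniformTail
import Literature.Analysis.FunctionSpaces.SobolevTraceDensityProofs
import HarnessLib

/-!
# The `L²` defect of the heat semigroup: `‖F − e^{tΔ}F‖_{L²} ≤ √(d t) ‖DF‖_{L²}`

Analysis/UnboundedOperators file (everything proved; no definitions, no named facts). For a
finite-dimensional real inner product space `E`, `0 < t`, the caloric extension
`e^{tΔ}F = heatKernel t ⋆ F` (`heatExtension`) and a field `F : E → F'` with values in a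
finite-dimensional real inner product space `F'` (`d = finrank ℝ F'`):

* `integral_sq_sub_heatExtension_le` — scalar, smooth: for `f ∈ C¹(E; ℝ)` with `f`, `Df`
  bounded, `f ∈ L²` and `‖Df‖² ∈ L¹`, `∫ (f − e^{tΔ}f)² ≤ t ∫ ‖Df‖²`;
* `integral_norm_sq_sub_heatExtension_le` — the same for `F : E → F'`, constant `d t`;
* `eLpNorm_smul_sub_heatExtension_smul_le` — the `H¹` form used downstream: for `f` with a weak
  derivative `Df` on an open `Ω`, `f, Df ∈ L²(Ω)`, and a smooth cut-off `ζ` compactly supported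
  in `Ω`, `‖ζf − e^{tΔ}(ζf)‖_{L²} ≤ √(d t) ‖ζ Df + Dζ ⊗ f‖_{L²}` (density of mollified
  approximants, `Literature.Analysis.FunctionSpaces.normed_convolution_approx`).

This is the elementary half of M. Ledoux's heat-flow proof of the refined Sobolev/Besov
inequalities (Ledoux 2003, §1: `‖f − P_t f‖₂ ≤ C√t ‖∇f‖₂`), in the sharp form with constant `1`
per component, and is the `L²` ingredient of the local weak-`L⁴` interpolation behind
Seregin–Zhou 2020, Lemma 2.1/2.3 (`Analysis/FluidPDE/SereginZhou2020WeakL4`).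

## Proof

For smooth scalar `f`: the Gaussian Poincaré inequality for the probability density
`G_t(x − ·)` (`sq_integral_heatKernel_poincare`) reads
`e^{tΔ}(f²)(x) − (e^{tΔ}f(x))² ≤ 2t e^{tΔ}(‖Df‖²)(x)`; integrating in `x` (the heat flow
preserves integrals) gives `‖f‖₂² − ‖e^{tΔ}f‖₂² ≤ 2t‖Df‖₂²`. By the symmetry of the kernel and
the semigroup law, `⟨f, e^{tΔ}f⟩ = ‖e^{(t/2)Δ}f‖₂² ≥ ‖e^{tΔ}f‖₂²` (contraction), hence
`‖f − e^{tΔ}f‖₂² = ‖f‖₂² − 2⟨f, e^{tΔ}f⟩ + ‖e^{tΔ}f‖₂² ≤ ‖f‖₂² − ‖e^{(t/2)Δ}f‖₂² ≤ t‖Df‖₂²`.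
Vector-valued `F` by components in an orthonormal basis; the `H¹` form by mollification.

## References

* M. Ledoux, *On improved Sobolev embedding theorems*, Math. Res. Lett. 10 (2003) 659–669, §1.
  [`Ledoux2003`]
* D. Bakry, I. Gentil, M. Ledoux, *Analysis and Geometry of Markov Diffusion Operators* (2014),
  Prop. 4.1.1 (Gaussian Poincaré inequality). [folklore]
-/

noncomputable section

open MeasureTheory Filter Topology Set InnerProductSpace Metric Function
open scoped Real ENNReal NNReal Convolution RealInnerProductSpace ContDiff

namespace Literature.Analysis.UnboundedOperators

variable {E : Type*} [NormedAddCommGroup E] [InnerProductSpace ℝ E] [FiniteDimensional ℝ E]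
  [MeasurableSpace E] [BorelSpace E]

/-! ### Bookkeeping: the heat flow preserves integrals; `L²` norms as integrals of squares -/

section Bookkeeping

variable {F : Type*} [NormedAddCommGroup F] [NormedSpace ℝ F] [CompleteSpace F]

omit [CompleteSpace F] in
/-- The caloric extension is the convolution `heatKernel t ⋆ f` (definitional). [folklore] -/
theorem heatExtension_eq_convolution (f : E → F) (t : ℝ) :
    heatExtension f t = (heatKernel t ⋆[ContinuousLinearMap.lsmul ℝ ℝ, volume] f) := rfl

/-- **The heat flow preserves integrals**: `∫ e^{tΔ}f = ∫ f` for integrable `f` and `0 < t`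
(`∫ heatKernel t = 1`; Fubini via Mathlib's `integral_convolution`). [folklore] -/
theorem integral_heatExtension_eq {f : E → F} (hf : Integrable f) {t : ℝ} (ht : 0 < t) :
    ∫ x, heatExtension f t x = ∫ x, f x := by
  rw [heatExtension_eq_convolution,
    integral_convolution (ContinuousLinearMap.lsmul ℝ ℝ) (integrable_heatKernel_holds ht) hf,
    integral_heatKernel_eq_one_holds ht, ContinuousLinearMap.lsmul_apply, one_smul]

omit [NormedSpace ℝ F] [CompleteSpace F] in
/-- `∫ ‖h‖² = (‖h‖_{L²})²` (real form) for `h ∈ L²`. [folklore] -/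
theorem integral_norm_sq_eq_toReal_eLpNorm_sq {h : E → F} (hh : MemLp h 2 volume) :
    ∫ x, ‖h x‖ ^ 2 = (eLpNorm h 2 volume).toReal ^ 2 := by
  have hI : 0 ≤ ∫ x, ‖h x‖ ^ 2 := integral_nonneg fun x => by positivity
  have h2 : ∫ x, ‖h x‖ ^ (2 : ℝ) = ∫ x, ‖h x‖ ^ 2 :=
    integral_congr_ae (Eventually.of_forall fun x => by simp)
  rw [hh.eLpNorm_eq_integral_rpow_norm two_ne_zero ENNReal.ofNat_ne_top, ENNReal.toReal_ofNat,
    h2, ENNReal.toReal_ofReal (by positivity), show (2 : ℝ)⁻¹ = 1 / 2 by norm_num,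
    ← Real.sqrt_eq_rpow, Real.sq_sqrt hI]

end Bookkeeping

/-! ### Scalar smooth data: the Poincaré route -/

section Scalar

variable {f : E → ℝ} {C₀ C₁ t : ℝ}

/-- **Gaussian Poincaré at a point**: for `f ∈ C¹(E)` with `f`, `Df` bounded and `0 < t`,
`e^{tΔ}(f²)(x) − (e^{tΔ}f(x))² ≤ 2t · e^{tΔ}(‖Df‖²)(x)` (the Poincaré inequality
`sq_integral_heatKernel_poincare` for the probability density `G_t(x − ·)`, applied to
`y ↦ f (x − y)`). [folklore] -/
theorem heatExtension_sq_sub_sq_le (ht : 0 < t) (hf : ContDiff ℝ 1 f)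
    (h0 : ∀ z, ‖f z‖ ≤ C₀) (h1 : ∀ z, ‖fderiv ℝ f z‖ ≤ C₁) (x : E) :
    heatExtension (fun z => f z ^ 2) t x - (heatExtension f t x) ^ 2 ≤
      2 * t * heatExtension (fun z => ‖fderiv ℝ f z‖ ^ 2) t x := by
  set g : E → ℝ := fun y => f (x - y) with hg
  have hgd : ContDiff ℝ 1 g := hf.comp (contDiff_const.sub contDiff_id)
  have hderiv : ∀ y, HasFDerivAt g (-(fderiv ℝ f (x - y))) y := fun y => by
    have h1 : HasFDerivAt f (fderiv ℝ f (x - y)) (x - y) :=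
      (hf.differentiable one_ne_zero (x - y)).hasFDerivAt
    have h2 : HasFDerivAt (fun y : E => x - y) (-(ContinuousLinearMap.id ℝ E)) y :=
      (hasFDerivAt_id y).const_sub x
    have := h1.comp y h2
    rwa [ContinuousLinearMap.comp_neg, ContinuousLinearMap.comp_id] at this
  have hfd : ∀ y, fderiv ℝ g y = -(fderiv ℝ f (x - y)) := fun y => (hderiv y).fderiv
  have hg0 : ∀ z, ‖g z‖ ≤ C₀ := fun z => h0 (x - z)
  have hg1 : ∀ z, ‖fderiv ℝ g z‖ ≤ C₁ := fun z => by rw [hfd, norm_neg]; exact h1 (x - z)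
  have key := sq_integral_heatKernel_poincare ht hgd hg0 hg1
  have e1 : ∫ z, g z ^ 2 * heatKernel t z = heatExtension (fun z => f z ^ 2) t x := by
    rw [heatExtension_apply]
    exact integral_congr_ae (Eventually.of_forall fun z => by simp [hg, smul_eq_mul, mul_comm])
  have e2 : ∫ z, g z * heatKernel t z = heatExtension f t x := by
    rw [heatExtension_apply]
    exact integral_congr_ae (Eventually.of_forall fun z => by simp [hg, smul_eq_mul, mul_comm])
  have e3 : ∫ z, ‖fderiv ℝ g z‖ ^ 2 * heatKernel t z =
      heatExtension (fun z => ‖fderiv ℝ f z‖ ^ 2) t x := by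
    rw [heatExtension_apply]
    exact integral_congr_ae (Eventually.of_forall fun z => by
      simp [hfd, norm_neg, smul_eq_mul, mul_comm])
  rwa [e1, e2, e3] at key

/-- **Integrated Poincaré**: for `f ∈ C¹(E)` with `f`, `Df` bounded, `f²` and `‖Df‖²` integrable
and `0 < t`, `∫ f² − ∫ (e^{tΔ}f)² ≤ 2t ∫ ‖Df‖²` (integrate `heatExtension_sq_sub_sq_le`; the heat
flow preserves integrals). [folklore] -/
theorem integral_sq_sub_integral_sq_heatExtension_le (ht : 0 < t) (hf : ContDiff ℝ 1 f)
    (h0 : ∀ z, ‖f z‖ ≤ C₀) (h1 : ∀ z, ‖fderiv ℝ f z‖ ≤ C₁)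
    (hf2 : Integrable (fun z => f z ^ 2)) (hD2 : Integrable (fun z => ‖fderiv ℝ f z‖ ^ 2)) :
    (∫ x, f x ^ 2) - ∫ x, (heatExtension f t x) ^ 2 ≤ 2 * t * ∫ x, ‖fderiv ℝ f x‖ ^ 2 := by
  -- the three `x`-integrands
  have hA : Integrable (heatExtension (fun z => f z ^ 2) t) := integrable_heatExtension hf2 ht
  have hC : Integrable (heatExtension (fun z => ‖fderiv ℝ f z‖ ^ 2) t) :=
    integrable_heatExtension hD2 ht
  have hf2' : MemLp f 2 volume :=
    (memLp_two_iff_integrable_sq hf.continuous.aestronglyMeasurable).2 hf2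
  have hB2 : MemLp (heatExtension f t) 2 volume := memLp_heatExtension_holds hf2' (by norm_num) ht
  have hB : Integrable (fun x => heatExtension f t x ^ 2) :=
    (memLp_two_iff_integrable_sq hB2.1).1 hB2
  have hpt : ∀ x, heatExtension (fun z => f z ^ 2) t x - heatExtension f t x ^ 2 ≤
      2 * t * heatExtension (fun z => ‖fderiv ℝ f z‖ ^ 2) t x :=
    heatExtension_sq_sub_sq_le ht hf h0 h1
  have hint := integral_mono (μ := volume)
    (f := fun x => heatExtension (fun z => f z ^ 2) t x - heatExtension f t x ^ 2)
    (g := fun x => 2 * t * heatExtension (fun z => ‖fderiv ℝ f z‖ ^ 2) t x)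
    (hA.sub hB) (hC.const_mul (2 * t)) hpt
  rw [integral_sub hA hB, integral_const_mul, integral_heatExtension_eq hf2 ht,
    integral_heatExtension_eq hD2 ht] at hint
  exact hint

/-- **Symmetry and the semigroup law**: `∫ f · e^{tΔ}f = ∫ (e^{(t/2)Δ}f)²` for `f ∈ L²`,
`0 < t` (the kernel is even; `e^{tΔ} = e^{(t/2)Δ} e^{(t/2)Δ}`). [folklore] -/
theorem integral_mul_heatExtension_eq_integral_sq (hf : MemLp f 2 volume) (ht : 0 < t) :
    ∫ x, f x * heatExtension f t x = ∫ x, (heatExtension f (t / 2) x) ^ 2 := by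
  have ht2 : 0 < t / 2 := half_pos ht
  have hK1 : Integrable (heatKernel (E := E) (t / 2)) := integrable_heatKernel_holds ht2
  have hK2 : MemLp (heatKernel (E := E) (t / 2)) 2 volume := memLp_heatKernel ht2 (by norm_num)
  have hh : MemLp (heatExtension f (t / 2)) 2 volume := memLp_heatExtension_holds hf (by norm_num) ht2
  have hint := integrable_kernel_mul_mul hK1 hK2 hf hh
  have hsymm : ∀ z : E, heatKernel (t / 2) (-z) = 1 * heatKernel (t / 2) z := fun z => by
    rw [heatKernel_neg, one_mul]
  have key := integral_convolution_mul_eq hsymm hint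
  rw [one_mul] at key
  -- `K_{t/2} ⋆ e^{(t/2)Δ} f = e^{tΔ} f`
  have hsg : (heatKernel (t / 2) ⋆[ContinuousLinearMap.lsmul ℝ ℝ, volume] heatExtension f (t / 2)) =
      heatExtension f t := by
    rw [← heatExtension_eq_convolution, heatExtension_add_holds hf (by norm_num) ht2 ht2, add_halves]
  rw [hsg, ← heatExtension_eq_convolution] at key
  rw [← key]
  exact integral_congr_ae (Eventually.of_forall fun x => by simp [pow_two])

/-- **Contraction along the semigroup**: `∫ (e^{tΔ}f)² ≤ ∫ (e^{(t/2)Δ}f)²` for `f ∈ L²`.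
[folklore] -/
theorem integral_sq_heatExtension_le_half (hf : MemLp f 2 volume) (ht : 0 < t) :
    ∫ x, (heatExtension f t x) ^ 2 ≤ ∫ x, (heatExtension f (t / 2) x) ^ 2 := by
  have ht2 : 0 < t / 2 := half_pos ht
  have hh : MemLp (heatExtension f (t / 2)) 2 volume := memLp_heatExtension_holds hf (by norm_num) ht2
  have hh2 : MemLp (heatExtension f t) 2 volume := memLp_heatExtension_holds hf (by norm_num) ht
  have hsg : heatExtension (heatExtension f (t / 2)) (t / 2) = heatExtension f t := by
    rw [heatExtension_add_holds hf (by norm_num) ht2 ht2, add_halves]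
  have hle : eLpNorm (heatExtension f t) 2 volume ≤ eLpNorm (heatExtension f (t / 2)) 2 volume := by
    rw [← hsg]; exact eLpNorm_heatExtension_le_holds hh (by norm_num) ht2
  have e1 : ∫ x, (heatExtension f t x) ^ 2 = (eLpNorm (heatExtension f t) 2 volume).toReal ^ 2 := by
    rw [← integral_norm_sq_eq_toReal_eLpNorm_sq hh2]
    exact integral_congr_ae (Eventually.of_forall fun x => by simp)
  have e2 : ∫ x, (heatExtension f (t / 2) x) ^ 2 =
      (eLpNorm (heatExtension f (t / 2)) 2 volume).toReal ^ 2 := by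
    rw [← integral_norm_sq_eq_toReal_eLpNorm_sq hh]
    exact integral_congr_ae (Eventually.of_forall fun x => by simp)
  rw [e1, e2]
  gcongr
  exact hh.eLpNorm_ne_top

/-- **The `L²` defect of the heat flow, scalar smooth data**: for `f ∈ C¹(E; ℝ)` with `f`, `Df`
bounded, `f²` and `‖Df‖²` integrable, and `0 < t`,
`∫ (f − e^{tΔ}f)² ≤ t ∫ ‖Df‖²` (Ledoux 2003, §1, with the sharp constant `1`).
[cite: Ledoux2003, §1 (heat-flow proof: ‖f − P_t f‖₂ ≤ C√t‖∇f‖₂)] -/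
theorem integral_sq_sub_heatExtension_le (ht : 0 < t) (hf : ContDiff ℝ 1 f)
    (h0 : ∀ z, ‖f z‖ ≤ C₀) (h1 : ∀ z, ‖fderiv ℝ f z‖ ≤ C₁)
    (hf2 : Integrable (fun z => f z ^ 2)) (hD2 : Integrable (fun z => ‖fderiv ℝ f z‖ ^ 2)) :
    ∫ x, (f x - heatExtension f t x) ^ 2 ≤ t * ∫ x, ‖fderiv ℝ f x‖ ^ 2 := by
  have hfm : AEStronglyMeasurable f volume := hf.continuous.aestronglyMeasurable
  have hf2' : MemLp f 2 volume := (memLp_two_iff_integrable_sq hfm).2 hf2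
  have hB2 : MemLp (heatExtension f t) 2 volume := memLp_heatExtension_holds hf2' (by norm_num) ht
  have hB : Integrable (fun x => heatExtension f t x ^ 2) := (memLp_two_iff_integrable_sq hB2.1).1 hB2
  have hfh : Integrable (fun x => f x * heatExtension f t x) := by
    have h1 : MemLp (fun x => f x * heatExtension f t x) 1 volume := hB2.mul' hf2'
    exact memLp_one_iff_integrable.1 h1
  -- expand the square
  have hexp : ∫ x, (f x - heatExtension f t x) ^ 2 =
      (∫ x, f x ^ 2) - 2 * (∫ x, f x * heatExtension f t x) + ∫ x, (heatExtension f t x) ^ 2 := by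
    have e : ∀ x, (f x - heatExtension f t x) ^ 2 =
        (f x ^ 2 - 2 * (f x * heatExtension f t x)) + heatExtension f t x ^ 2 := fun x => by ring
    simp_rw [e]
    rw [integral_add (f := fun x => f x ^ 2 - 2 * (f x * heatExtension f t x))
        (g := fun x => heatExtension f t x ^ 2) (hf2.sub (hfh.const_mul 2)) hB,
      integral_sub (f := fun x => f x ^ 2) (g := fun x => 2 * (f x * heatExtension f t x)) hf2
        (hfh.const_mul 2), integral_const_mul]
  have hS := integral_mul_heatExtension_eq_integral_sq hf2' ht
  have hP := integral_sq_sub_integral_sq_heatExtension_le (half_pos ht) hf h0 h1 hf2 hD2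
  have hc := integral_sq_heatExtension_le_half hf2' ht
  linarith [hexp, hS, hP, hc]

end Scalar

/-! ### Vector-valued smooth data, by components -/

section Vector

variable {F' : Type*} [NormedAddCommGroup F'] [InnerProductSpace ℝ F'] [FiniteDimensional ℝ F']
variable {F : E → F'} {C₀ C₁ t : ℝ}

omit [InnerProductSpace ℝ E] [FiniteDimensional ℝ E] [MeasurableSpace E] [BorelSpace E]
  [FiniteDimensional ℝ F'] in
/-- Parseval in an orthonormal basis: `‖v‖² = ∑ᵢ ⟪bᵢ, v⟫²`. [folklore] -/
theorem norm_sq_eq_sum_sq_inner {ι : Type*} [Fintype ι] (b : OrthonormalBasis ι ℝ F') (v : F') :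
    ‖v‖ ^ 2 = ∑ i, ⟪b i, v⟫ ^ 2 := by
  rw [← real_inner_self_eq_norm_sq, ← b.sum_inner_mul_inner v v]
  exact Finset.sum_congr rfl fun i _ => by rw [real_inner_comm (b i) v, pow_two]

omit [NormedAddCommGroup E] [InnerProductSpace ℝ E] [FiniteDimensional ℝ E] [MeasurableSpace E]
  [BorelSpace E] [FiniteDimensional ℝ F'] in
/-- A component `x ↦ ⟪w, F x⟫` of a bounded field is bounded by `‖w‖ · bound`. [folklore] -/
theorem norm_inner_apply_le {w : F'} {C : ℝ} (h : ∀ z, ‖F z‖ ≤ C) (z : E) :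
    ‖⟪w, F z⟫‖ ≤ ‖w‖ * C :=
  (norm_inner_le_norm w (F z)).trans (mul_le_mul_of_nonneg_left (h z) (norm_nonneg w))

/-- **The `L²` defect of the heat flow, vector-valued smooth data**: for `F ∈ C¹(E; F')` with
`F`, `DF` bounded, `‖F‖²` and `‖DF‖²` integrable, `0 < t` and `d = finrank ℝ F'`,
`∫ ‖F − e^{tΔ}F‖² ≤ d · t ∫ ‖DF‖²` (the scalar estimate `integral_sq_sub_heatExtension_le` in
each coordinate of an orthonormal basis of `F'`; `‖D⟪bᵢ, F⟫‖ ≤ ‖DF‖`).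
[cite: Ledoux2003, §1 (heat-flow proof: ‖f − P_t f‖₂ ≤ C√t‖∇f‖₂)] -/
theorem integral_norm_sq_sub_heatExtension_le (ht : 0 < t) (hF : ContDiff ℝ 1 F)
    (h0 : ∀ z, ‖F z‖ ≤ C₀) (h1 : ∀ z, ‖fderiv ℝ F z‖ ≤ C₁)
    (hF2 : Integrable (fun z => ‖F z‖ ^ 2)) (hD2 : Integrable (fun z => ‖fderiv ℝ F z‖ ^ 2)) :
    ∫ x, ‖F x - heatExtension F t x‖ ^ 2 ≤
      (Module.finrank ℝ F' : ℝ) * t * ∫ x, ‖fderiv ℝ F x‖ ^ 2 := by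
  haveI : CompleteSpace F' := FiniteDimensional.complete ℝ F'
  set b := stdOrthonormalBasis ℝ F' with hb
  set Fi : Fin (Module.finrank ℝ F') → E → ℝ := fun i x => ⟪b i, F x⟫ with hFi
  have hbi : ∀ i, ‖b i‖ = 1 := fun i => b.orthonormal.1 i
  have hFd : Differentiable ℝ F := hF.differentiable one_ne_zero
  -- calculus of the components
  have hFi_d : ∀ i, ContDiff ℝ 1 (Fi i) := fun i => contDiff_const.inner ℝ hF
  have hFi_fd : ∀ i x y, fderiv ℝ (Fi i) x y = ⟪b i, fderiv ℝ F x y⟫ := by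
    intro i x y
    rw [hFi]
    dsimp only
    rw [fderiv_inner_apply ℝ (differentiableAt_const _) (hFd x)]
    simp
  have hFi_nfd : ∀ i x, ‖fderiv ℝ (Fi i) x‖ ≤ ‖fderiv ℝ F x‖ := fun i x => by
    refine ContinuousLinearMap.opNorm_le_bound _ (norm_nonneg _) fun y => ?_
    rw [hFi_fd]
    calc ‖⟪b i, fderiv ℝ F x y⟫‖ ≤ ‖b i‖ * ‖fderiv ℝ F x y‖ := norm_inner_le_norm _ _
      _ ≤ 1 * (‖fderiv ℝ F x‖ * ‖y‖) := by
          rw [hbi]; gcongr; exact ContinuousLinearMap.le_opNorm _ _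
      _ = ‖fderiv ℝ F x‖ * ‖y‖ := one_mul _
  have hFi0 : ∀ i z, ‖Fi i z‖ ≤ 1 * C₀ := fun i z => by
    have := norm_inner_apply_le (w := b i) h0 z
    rwa [hbi] at this
  have hFi1 : ∀ i z, ‖fderiv ℝ (Fi i) z‖ ≤ C₁ := fun i z => (hFi_nfd i z).trans (h1 z)
  -- integrability of the components
  have hFi_m : ∀ i, AEStronglyMeasurable (Fi i) volume := fun i =>
    (hFi_d i).continuous.aestronglyMeasurable
  have hFi2 : ∀ i, Integrable (fun z => Fi i z ^ 2) := fun i => by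
    refine hF2.mono ((hFi_m i).pow 2) (Eventually.of_forall fun z => ?_)
    rw [Real.norm_eq_abs, abs_pow, Real.norm_eq_abs, abs_pow, abs_norm, sq_le_sq, abs_abs,
      abs_norm]
    have := norm_inner_le_norm (𝕜 := ℝ) (b i) (F z)
    rw [hbi, one_mul] at this
    simpa [hFi] using this
  have hDi_m : ∀ i, AEStronglyMeasurable (fun z => ‖fderiv ℝ (Fi i) z‖ ^ 2) volume := fun i =>
    (((hFi_d i).continuous_fderiv one_ne_zero).norm.pow 2).aestronglyMeasurable
  have hDi2 : ∀ i, Integrable (fun z => ‖fderiv ℝ (Fi i) z‖ ^ 2) := fun i => by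
    refine hD2.mono (hDi_m i) (Eventually.of_forall fun z => ?_)
    rw [Real.norm_eq_abs, abs_pow, abs_norm, Real.norm_eq_abs, abs_pow, abs_norm]
    exact pow_le_pow_left₀ (norm_nonneg _) (hFi_nfd i z) 2
  -- the scalar estimate per component
  have hcomp : ∀ i, ∫ x, (Fi i x - heatExtension (Fi i) t x) ^ 2 ≤
      t * ∫ x, ‖fderiv ℝ (Fi i) x‖ ^ 2 := fun i =>
    integral_sq_sub_heatExtension_le ht (hFi_d i) (hFi0 i) (hFi1 i) (hFi2 i) (hDi2 i)
  have hcomp' : ∀ i, ∫ x, (Fi i x - heatExtension (Fi i) t x) ^ 2 ≤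
      t * ∫ x, ‖fderiv ℝ F x‖ ^ 2 := fun i => by
    refine (hcomp i).trans (mul_le_mul_of_nonneg_left ?_ ht.le)
    exact integral_mono (hDi2 i) hD2 fun z => pow_le_pow_left₀ (norm_nonneg _) (hFi_nfd i z) 2
  -- heat flow of the components
  have hheat : ∀ i x, heatExtension (Fi i) t x = ⟪b i, heatExtension F t x⟫ := fun i x => by
    have := heatExtension_clm_comp_of_bound (innerSL ℝ (b i)) hF.continuous h0 ht x
    simpa [hFi] using this
  -- pointwise Parseval for the defect
  have hpt : ∀ x, ‖F x - heatExtension F t x‖ ^ 2 =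
      ∑ i, (Fi i x - heatExtension (Fi i) t x) ^ 2 := fun x => by
    rw [norm_sq_eq_sum_sq_inner b]
    exact Finset.sum_congr rfl fun i _ => by rw [hheat, inner_sub_right]
  -- integrability of the squared component defects
  have hFi2' : ∀ i, MemLp (Fi i) 2 volume := fun i => (memLp_two_iff_integrable_sq (hFi_m i)).2 (hFi2 i)
  have hdef : ∀ i, Integrable (fun x => (Fi i x - heatExtension (Fi i) t x) ^ 2) := fun i => by
    have h := (hFi2' i).sub (memLp_heatExtension_holds (hFi2' i) (by norm_num) ht)
    exact (memLp_two_iff_integrable_sq h.1).1 h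
  -- assemble
  calc ∫ x, ‖F x - heatExtension F t x‖ ^ 2
      = ∫ x, ∑ i, (Fi i x - heatExtension (Fi i) t x) ^ 2 :=
        integral_congr_ae (Eventually.of_forall hpt)
    _ = ∑ i, ∫ x, (Fi i x - heatExtension (Fi i) t x) ^ 2 :=
        integral_finsetSum _ fun i _ => hdef i
    _ ≤ ∑ _i : Fin (Module.finrank ℝ F'), t * ∫ x, ‖fderiv ℝ F x‖ ^ 2 :=
        Finset.sum_le_sum fun i _ => hcomp' i
    _ = (Module.finrank ℝ F' : ℝ) * t * ∫ x, ‖fderiv ℝ F x‖ ^ 2 := by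
        rw [Finset.sum_const, Finset.card_univ, Fintype.card_fin, nsmul_eq_mul]; ring

end Vector

/-! ### Data in `W^{1,2}(Ω)` cut off inside `Ω`: density -/

section Density

variable {F' : Type*} [NormedAddCommGroup F'] [InnerProductSpace ℝ F'] [FiniteDimensional ℝ F']

omit [FiniteDimensional ℝ F'] in
/-- **A cut-off product has a global weak derivative.** If `Df` is a weak derivative of `f` on
the open set `Ω` and `ζ ∈ C_c^∞` has `tsupport ζ ⊆ Ω`, then `ζ Df + Dζ ⊗ f` is a weak
derivative of `ζ • f` on the whole space (the product rule tested against `ζ φ`, which is a test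
function on `Ω` for every smooth `φ`; Adams, *Sobolev Spaces* (1975), ¶1.58 and Lemma 3.15).
[folklore] -/
theorem hasWeakFDerivOn_top_smul {Ω : TopologicalSpace.Opens E} {f : E → F'}
    {Df : E → E →L[ℝ] F'} (hw : FunctionSpaces.HasWeakFDerivOn Ω volume f Df) {ζ : E → ℝ}
    (hζ : ContDiff ℝ ∞ ζ) (hζc : HasCompactSupport ζ) (hζΩ : tsupport ζ ⊆ (Ω : Set E)) :
    FunctionSpaces.HasWeakFDerivOn ⊤ volume (fun x => ζ x • f x)
      (fun x => ζ x • Df x + (fderiv ℝ ζ x).smulRight (f x)) := by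
  have hζ1 : ContDiff ℝ 1 ζ := hζ.of_le (by exact_mod_cast le_top)
  have hζd : Differentiable ℝ ζ := hζ1.differentiable one_ne_zero
  -- global integrability: everything vanishes off `tsupport ζ ⊆ Ω`
  have hG : Integrable (fun x => ζ x • f x) := by
    refine (FunctionSpaces.SobolevApprox.integrableOn_continuous_smul hζ.continuous hζc hζΩ
      hw.locallyIntegrableOn).integrable_of_forall_notMem_eq_zero fun x hx => ?_
    rw [image_eq_zero_of_notMem_tsupport (fun h => hx (hζΩ h)), zero_smul]
  have hg1 : Integrable (fun x => ζ x • Df x) := by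
    refine (FunctionSpaces.SobolevApprox.integrableOn_continuous_smul (F := E →L[ℝ] F')
      hζ.continuous hζc hζΩ hw.locallyIntegrableOn_deriv).integrable_of_forall_notMem_eq_zero
      fun x hx => ?_
    rw [image_eq_zero_of_notMem_tsupport (fun h => hx (hζΩ h)), zero_smul]
  have hg2 : Integrable (fun x => (fderiv ℝ ζ x).smulRight (f x)) := by
    have hloc := FunctionSpaces.SobolevApprox.locallyIntegrableOn_fderiv_smulRight (μ := volume)
      (Ω := Ω) hζ1 hw.locallyIntegrableOn
    have hK : IntegrableOn (fun x => (fderiv ℝ ζ x).smulRight (f x)) (tsupport ζ) volume :=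
      hloc.integrableOn_compact_subset hζΩ hζc
    refine hK.integrable_of_forall_notMem_eq_zero (ε' := E →L[ℝ] F') fun x hx => ?_
    simp [fderiv_of_notMem_tsupport ℝ hx]
  refine ⟨?_, ?_, fun φ v hφ => ?_⟩
  · exact (hG.locallyIntegrable).locallyIntegrableOn _
  · exact LocallyIntegrableOn.add (ε'' := E →L[ℝ] F') (hg1.locallyIntegrable.locallyIntegrableOn _)
      (hg2.locallyIntegrable.locallyIntegrableOn _)
  -- the identity: test the product rule on `Ω` against `ζ φ`
  have hφd : Differentiable ℝ φ := hφ.contDiff.differentiable (by simp)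
  have hψ : FunctionSpaces.IsTestFunctionOn Ω (fun x => ζ x * φ x) :=
    ⟨hζ.mul hφ.contDiff, hζc.mul_right, (tsupport_mul_subset_left (f := ζ) (g := φ)).trans hζΩ⟩
  have hψ' : ∀ x, fderiv ℝ (fun x => ζ x * φ x) x v =
      ζ x * fderiv ℝ φ x v + φ x * fderiv ℝ ζ x v := fun x => by
    rw [fderiv_fun_mul (hζd x) (hφd x)]
    simp [smul_eq_mul]
  have key := hw.integral_fderiv_smul_eq _ v hψ
  simp only [hψ'] at key
  -- integrability of the three pieces on `Ω`
  have hc1 : Continuous fun x => fderiv ℝ φ x v :=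
    (hφ.contDiff.continuous_fderiv (by simp)).clm_apply continuous_const
  have hc2 : Continuous fun x => fderiv ℝ ζ x v :=
    (hζ.continuous_fderiv (by simp)).clm_apply continuous_const
  have i1 : IntegrableOn (fun x => (ζ x * fderiv ℝ φ x v) • f x) (Ω : Set E) volume :=
    FunctionSpaces.SobolevApprox.integrableOn_continuous_smul (hζ.continuous.mul hc1)
      hζc.mul_right ((tsupport_mul_subset_left (f := ζ) (g := fun x => fderiv ℝ φ x v)).trans hζΩ)
      hw.locallyIntegrableOn
  have i2 : IntegrableOn (fun x => (φ x * fderiv ℝ ζ x v) • f x) (Ω : Set E) volume :=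
    FunctionSpaces.SobolevApprox.integrableOn_continuous_smul (hφ.contDiff.continuous.mul hc2)
      (hζc.fderiv_apply (𝕜 := ℝ) v).mul_left
      ((tsupport_mul_subset_right (f := φ) (g := fun x => fderiv ℝ ζ x v)).trans
        ((tsupport_fderiv_apply_subset ℝ v).trans hζΩ))
      hw.locallyIntegrableOn
  have i3 : IntegrableOn (fun x => (φ x * ζ x) • Df x v) (Ω : Set E) volume :=
    FunctionSpaces.SobolevApprox.integrableOn_continuous_smul (hφ.contDiff.continuous.mul hζ.continuous)
      hζc.mul_left ((tsupport_mul_subset_right (f := φ) (g := ζ)).trans hζΩ)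
      (FunctionSpaces.SobolevApprox.locallyIntegrableOn_deriv_apply hw v)
  -- pass from `univ` to `Ω`
  have hΩ1 : ∫ x in (⊤ : TopologicalSpace.Opens E), fderiv ℝ φ x v • (ζ x • f x) =
      ∫ x in (Ω : Set E), (ζ x * fderiv ℝ φ x v) • f x := by
    rw [TopologicalSpace.Opens.coe_top, Measure.restrict_univ,
      ← setIntegral_eq_integral_of_forall_compl_eq_zero (s := (Ω : Set E)) (fun x hx => ?_)]
    · exact integral_congr_ae (Eventually.of_forall fun x => by dsimp only; rw [smul_smul, mul_comm])
    · rw [image_eq_zero_of_notMem_tsupport (fun h => hx (hζΩ h)), zero_smul, smul_zero]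
  have hΩ2 : ∫ x in (⊤ : TopologicalSpace.Opens E),
      φ x • ((ζ x • Df x + (fderiv ℝ ζ x).smulRight (f x)) v) =
      (∫ x in (Ω : Set E), (φ x * ζ x) • Df x v) +
        ∫ x in (Ω : Set E), (φ x * fderiv ℝ ζ x v) • f x := by
    rw [TopologicalSpace.Opens.coe_top, Measure.restrict_univ, ← integral_add i3 i2,
      ← setIntegral_eq_integral_of_forall_compl_eq_zero (s := (Ω : Set E)) (fun x hx => ?_)]
    · refine integral_congr_ae (Eventually.of_forall fun x => ?_)
      simp only [_root_.add_apply, FunLike.coe_smul, Pi.smul_apply,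
        ContinuousLinearMap.smulRight_apply, smul_add, smul_smul]
    · have hx' : x ∉ tsupport ζ := fun h => hx (hζΩ h)
      rw [image_eq_zero_of_notMem_tsupport hx', fderiv_of_notMem_tsupport ℝ hx']
      simp
  rw [hΩ1, hΩ2]
  have split : ∫ x in (Ω : Set E), (ζ x * fderiv ℝ φ x v + φ x * fderiv ℝ ζ x v) • f x =
      (∫ x in (Ω : Set E), (ζ x * fderiv ℝ φ x v) • f x) +
        ∫ x in (Ω : Set E), (φ x * fderiv ℝ ζ x v) • f x := by
    rw [← integral_add i1 i2]
    exact integral_congr_ae (Eventually.of_forall fun x => by dsimp only; rw [add_smul])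
  rw [split] at key
  have e3 : ∫ x in (Ω : Set E), (ζ x * φ x) • Df x v = ∫ x in (Ω : Set E), (φ x * ζ x) • Df x v :=
    integral_congr_ae (Eventually.of_forall fun x => by dsimp only; rw [mul_comm])
  rw [e3] at key
  rw [neg_add']
  exact eq_sub_of_add_eq key

/-- The zero extension of a cut-off of `L^p(Ω)` data is in `L^p`. [folklore] -/
theorem memLp_smul_of_tsupport_subset {G : Type*} [NormedAddCommGroup G] [NormedSpace ℝ G]
    {Ω : TopologicalSpace.Opens E} {h : E → G} {p : ℝ≥0∞} (hh : MemLp h p (volume.restrict Ω))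
    {ζ : E → ℝ} (hζ : Continuous ζ) (hζc : HasCompactSupport ζ) (hζΩ : tsupport ζ ⊆ (Ω : Set E)) :
    MemLp (fun x => ζ x • h x) p volume := by
  have h1 : MemLp (fun x => ζ x • h x) p (volume.restrict Ω) :=
    FunctionSpaces.SobolevApprox.memLp_continuous_smul hζ hζc hh
  have h2 : (fun x => ζ x • h x) = (Ω : Set E).indicator fun x => ζ x • h x := by
    funext x
    by_cases hx : x ∈ (Ω : Set E)
    · rw [indicator_of_mem hx]
    · rw [indicator_of_notMem hx, image_eq_zero_of_notMem_tsupport (fun h => hx (hζΩ h)),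
        zero_smul]
  rw [h2]
  exact (memLp_indicator_iff_restrict Ω.isOpen.measurableSet).2 h1

omit [FiniteDimensional ℝ F'] in
/-- The rank-one term `Dζ ⊗ f` of the product rule, zero-extended, is in `L^p`. [folklore] -/
theorem memLp_fderiv_smulRight_of_tsupport_subset {Ω : TopologicalSpace.Opens E} {f : E → F'}
    {p : ℝ≥0∞} (hf : MemLp f p (volume.restrict Ω)) {ζ : E → ℝ} (hζ : ContDiff ℝ 1 ζ)
    (hζc : HasCompactSupport ζ) (hζΩ : tsupport ζ ⊆ (Ω : Set E)) :
    MemLp (fun x => (fderiv ℝ ζ x).smulRight (f x)) p volume := by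
  have h1 : MemLp (fun x => (fderiv ℝ ζ x).smulRight (f x)) p (volume.restrict Ω) :=
    FunctionSpaces.SobolevApprox.memLp_fderiv_smulRight hζ hζc hf
  have h2 : (fun x => (fderiv ℝ ζ x).smulRight (f x)) =
      (Ω : Set E).indicator fun x => (fderiv ℝ ζ x).smulRight (f x) := by
    funext x
    by_cases hx : x ∈ (Ω : Set E)
    · rw [indicator_of_mem hx]
    · rw [indicator_of_notMem hx]
      simp [fderiv_of_notMem_tsupport ℝ (fun h => hx (hζΩ h))]
  rw [h2]
  exact (memLp_indicator_iff_restrict (ε := E →L[ℝ] F') Ω.isOpen.measurableSet).2 h1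

/-- `L²` bookkeeping: from `(‖a‖₂)² ≤ K² (‖b‖₂)²`-type real inequalities to `eLpNorm`. [folklore] -/
theorem eLpNorm_le_of_toReal_sq_le {a b : ℝ≥0∞} (ha : a ≠ ⊤) (hb : b ≠ ⊤) {K : ℝ} (hK : 0 ≤ K)
    (h : a.toReal ^ 2 ≤ K * b.toReal ^ 2) : a ≤ ENNReal.ofReal (Real.sqrt K) * b := by
  have h1 : a.toReal ≤ Real.sqrt K * b.toReal := by
    have := Real.sqrt_le_sqrt h
    rwa [Real.sqrt_sq ENNReal.toReal_nonneg, Real.sqrt_mul hK, Real.sqrt_sq ENNReal.toReal_nonneg]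
      at this
  calc a = ENNReal.ofReal a.toReal := (ENNReal.ofReal_toReal ha).symm
    _ ≤ ENNReal.ofReal (Real.sqrt K * b.toReal) := ENNReal.ofReal_le_ofReal h1
    _ = ENNReal.ofReal (Real.sqrt K) * b := by
        rw [ENNReal.ofReal_mul (Real.sqrt_nonneg K), ENNReal.ofReal_toReal hb]

/-- The smooth estimate `integral_norm_sq_sub_heatExtension_le` in `eLpNorm` form, for smooth
compactly supported `ψ`. [folklore] -/
theorem eLpNorm_sub_heatExtension_le_of_hasCompactSupport {ψ : E → F'} (hψ : ContDiff ℝ 1 ψ)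
    (hψc : HasCompactSupport ψ) {t : ℝ} (ht : 0 < t) :
    eLpNorm (ψ - heatExtension ψ t) 2 volume ≤
      ENNReal.ofReal (Real.sqrt ((Module.finrank ℝ F' : ℝ) * t)) *
        eLpNorm (fderiv ℝ ψ) 2 volume := by
  haveI : CompleteSpace F' := FiniteDimensional.complete ℝ F'
  have hcont : Continuous ψ := hψ.continuous
  have hDcont : Continuous (fderiv ℝ ψ) := hψ.continuous_fderiv one_ne_zero
  have hDc : HasCompactSupport (fderiv ℝ ψ) := hψc.fderiv ℝ
  obtain ⟨C₀, hC₀⟩ := hcont.bounded_above_of_compact_support hψc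
  obtain ⟨C₁, hC₁⟩ := hDcont.bounded_above_of_compact_support hDc
  have hm0 : MemLp ψ 2 volume := hcont.memLp_of_hasCompactSupport hψc
  have hm1 : MemLp (ψ - heatExtension ψ t) 2 volume :=
    hm0.sub (memLp_heatExtension_holds hm0 (by norm_num) ht)
  have hm2 : MemLp (fderiv ℝ ψ) 2 volume := hDcont.memLp_of_hasCompactSupport hDc
  have h2 : Integrable (fun x => ‖ψ x‖ ^ 2) := (memLp_two_iff_integrable_sq_norm hm0.1).1 hm0
  have hD2 : Integrable (fun x => ‖fderiv ℝ ψ x‖ ^ 2) :=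
    (memLp_two_iff_integrable_sq_norm hm2.1).1 hm2
  have key := integral_norm_sq_sub_heatExtension_le ht hψ hC₀ hC₁ h2 hD2
  have e1 : ∫ x, ‖ψ x - heatExtension ψ t x‖ ^ 2 = (eLpNorm (ψ - heatExtension ψ t) 2 volume).toReal ^ 2 :=
    integral_norm_sq_eq_toReal_eLpNorm_sq hm1
  rw [e1, integral_norm_sq_eq_toReal_eLpNorm_sq hm2] at key
  exact eLpNorm_le_of_toReal_sq_le hm1.eLpNorm_ne_top hm2.eLpNorm_ne_top (by positivity) key

/-- **The `L²` defect of the heat flow for a cut-off of `W^{1,2}(Ω)` data.** Let `Df` be a weak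
derivative of `f` on the open set `Ω` with `f, Df ∈ L²(Ω)`, let `ζ ∈ C_c^∞` with
`tsupport ζ ⊆ Ω`, `0 < t` and `d = finrank ℝ F'`. Then
`‖ζf − e^{tΔ}(ζf)‖_{L²} ≤ √(d t) ‖ζ Df + Dζ ⊗ f‖_{L²}`. (The smooth case by density of the
mollified approximants `Literature.Analysis.FunctionSpaces.SobolevApprox.normed_convolution_approx`;
the heat flow is an `L²` contraction.) This is the `L²` half of Ledoux's heat-flow proof of the
refined Sobolev inequalities (Ledoux 2003, §1).
[cite: Ledoux2003, §1 (heat-flow proof: ‖f − P_t f‖₂ ≤ C√t‖∇f‖₂)] -/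
theorem eLpNorm_smul_sub_heatExtension_smul_le {Ω : TopologicalSpace.Opens E} {f : E → F'}
    {Df : E → E →L[ℝ] F'} (hw : FunctionSpaces.HasWeakFDerivOn Ω volume f Df)
    (hf : MemLp f 2 (volume.restrict Ω)) (hDf : MemLp Df 2 (volume.restrict Ω))
    {ζ : E → ℝ} (hζ : ContDiff ℝ ∞ ζ) (hζc : HasCompactSupport ζ)
    (hζΩ : tsupport ζ ⊆ (Ω : Set E)) {t : ℝ} (ht : 0 < t) :
    eLpNorm ((fun x => ζ x • f x) - heatExtension (fun x => ζ x • f x) t) 2 volume ≤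
      ENNReal.ofReal (Real.sqrt ((Module.finrank ℝ F' : ℝ) * t)) *
        eLpNorm (fun x => ζ x • Df x + (fderiv ℝ ζ x).smulRight (f x)) 2 volume := by
  haveI : CompleteSpace F' := FiniteDimensional.complete ℝ F'
  set G : E → F' := fun x => ζ x • f x with hGdef
  set g : E → E →L[ℝ] F' := fun x => ζ x • Df x + (fderiv ℝ ζ x).smulRight (f x) with hgdef
  set K : ℝ≥0∞ := ENNReal.ofReal (Real.sqrt ((Module.finrank ℝ F' : ℝ) * t)) with hK
  have hζ1 : ContDiff ℝ 1 ζ := hζ.of_le (by exact_mod_cast le_top)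
  -- the global data
  have hwG : FunctionSpaces.HasWeakFDerivOn ⊤ volume G g := hasWeakFDerivOn_top_smul hw hζ hζc hζΩ
  have hG2 : MemLp G 2 volume := memLp_smul_of_tsupport_subset hf hζ.continuous hζc hζΩ
  have hg2 : MemLp g 2 volume := by
    have h1 : MemLp (fun x => ζ x • Df x) 2 volume :=
      memLp_smul_of_tsupport_subset hDf hζ.continuous hζc hζΩ
    have h2 := memLp_fderiv_smulRight_of_tsupport_subset hf hζ1 hζc hζΩ
    have := MemLp.add (ε := E →L[ℝ] F') h1 h2
    exact this
  have hGc : HasCompactSupport G := hζc.smul_right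
  -- mollifiers centred at `0` with radii `→ 0`
  set φ : ∀ n : ℕ, ContDiffBump ((fun _ : ℕ => (0 : E)) n) := fun n =>
    ⟨1 / (2 * ((n : ℝ) + 1)), 1 / ((n : ℝ) + 1), by positivity,
      one_div_lt_one_div_of_lt (by positivity) (by linarith)⟩ with hφ
  have hr : Tendsto (fun n => (φ n).rOut) atTop (𝓝 0) := tendsto_one_div_add_atTop_nhds_zero_nat
  obtain ⟨hsm, -, hlim, hlimD⟩ := FunctionSpaces.SobolevApprox.normed_convolution_approx
    (Ω := (⊤ : TopologicalSpace.Opens E)) (μ := volume) φ tendsto_const_nhds hr (p := 2)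
    (by norm_num) (by norm_num) hG2 hg2 hwG (fun n x _ => ⟨⊤, subset_univ _, hwG⟩)
  set ψ : ℕ → E → F' := fun n => (φ n).normed volume ⋆[ContinuousLinearMap.lsmul ℝ ℝ, volume] G
    with hψdef
  rw [TopologicalSpace.Opens.coe_top, Measure.restrict_univ] at hlim hlimD
  -- properties of the approximants
  have hψc : ∀ n, HasCompactSupport (ψ n) := fun n =>
    HasCompactSupport.convolution (L := ContinuousLinearMap.lsmul ℝ ℝ) (φ n).hasCompactSupport_normed hGc
  have hψd : ∀ n, ContDiff ℝ 1 (ψ n) := fun n => (hsm n).of_le (by exact_mod_cast le_top)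
  have hψm : ∀ n, MemLp (ψ n) 2 volume := fun n =>
    (hψd n).continuous.memLp_of_hasCompactSupport (hψc n)
  have hDψm : ∀ n, MemLp (fderiv ℝ (ψ n)) 2 volume := fun n =>
    ((hψd n).continuous_fderiv one_ne_zero).memLp_of_hasCompactSupport ((hψc n).fderiv ℝ)
  have hsmooth : ∀ n, eLpNorm (ψ n - heatExtension (ψ n) t) 2 volume ≤
      K * eLpNorm (fderiv ℝ (ψ n)) 2 volume := fun n =>
    eLpNorm_sub_heatExtension_le_of_hasCompactSupport (hψd n) (hψc n) ht
  -- measurability bookkeeping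
  have hGm : AEStronglyMeasurable G volume := hG2.1
  have hgm : AEStronglyMeasurable g volume := hg2.1
  have hhG : MemLp (heatExtension G t) 2 volume := memLp_heatExtension_holds hG2 (by norm_num) ht
  have hhψ : ∀ n, MemLp (heatExtension (ψ n) t) 2 volume := fun n =>
    memLp_heatExtension_holds (hψm n) (by norm_num) ht
  -- the heat flow is linear and contractive on `L²`
  have hcontr : ∀ n, eLpNorm (heatExtension (ψ n) t - heatExtension G t) 2 volume ≤
      eLpNorm (G - ψ n) 2 volume := by
    intro n
    have hlin : heatExtension (ψ n) t - heatExtension G t = heatExtension (ψ n - G) t := by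
      funext x
      have h := heatExtension_add_apply_of_memLp' ((hψm n).sub hG2) hG2 (by norm_num) ht x
      rw [sub_add_cancel] at h
      rw [Pi.sub_apply, h, add_sub_cancel_right]
    rw [hlin, eLpNorm_sub_comm G (ψ n)]
    exact eLpNorm_heatExtension_le_holds ((hψm n).sub hG2) (by norm_num) ht
  -- control of `‖Dψₙ‖₂` by `‖g‖₂` and the componentwise errors
  set b := Module.finBasis ℝ E with hb
  set C : ℝ≥0 := (Fintype.card (Fin (Module.finrank ℝ E)) •
    ‖(b.equivFunL : E →L[ℝ] Fin (Module.finrank ℝ E) → ℝ)‖₊ : ℝ≥0) with hC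
  have hDψ_le : ∀ n, eLpNorm (fderiv ℝ (ψ n)) 2 volume ≤
      eLpNorm g 2 volume + C * ∑ i, eLpNorm (fun x => (g - fderiv ℝ (ψ n)) x (b i)) 2 volume := by
    intro n
    have h1 : eLpNorm (fderiv ℝ (ψ n)) 2 volume ≤
        eLpNorm g 2 volume + eLpNorm (g - fderiv ℝ (ψ n)) 2 volume := by
      have : fderiv ℝ (ψ n) = g - (g - fderiv ℝ (ψ n)) := by simp
      conv_lhs => rw [this]
      exact eLpNorm_sub_le hgm (hgm.sub (hDψm n).1) (by norm_num)
    refine h1.trans (add_le_add le_rfl ?_)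
    exact FunctionSpaces.SobolevApprox.eLpNorm_le_mul_sum_eLpNorm_apply_basis b
      (hgm.sub (hDψm n).1) (by norm_num)
  -- the estimate for every `n`
  have hmain : ∀ n, eLpNorm (G - heatExtension G t) 2 volume ≤
      2 * eLpNorm (G - ψ n) 2 volume +
        K * (eLpNorm g 2 volume +
          C * ∑ i, eLpNorm (fun x => (g - fderiv ℝ (ψ n)) x (b i)) 2 volume) := by
    intro n
    have hsplit : G - heatExtension G t =
        (G - ψ n) + ((ψ n - heatExtension (ψ n) t) + (heatExtension (ψ n) t - heatExtension G t)) := by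
      abel
    have m1 : AEStronglyMeasurable (G - ψ n) volume := hGm.sub (hψm n).1
    have m2 : AEStronglyMeasurable (ψ n - heatExtension (ψ n) t) volume := (hψm n).1.sub (hhψ n).1
    have m3 : AEStronglyMeasurable (heatExtension (ψ n) t - heatExtension G t) volume :=
      (hhψ n).1.sub hhG.1
    calc eLpNorm (G - heatExtension G t) 2 volume
        = eLpNorm ((G - ψ n) + ((ψ n - heatExtension (ψ n) t) +
            (heatExtension (ψ n) t - heatExtension G t))) 2 volume := by rw [← hsplit]
      _ ≤ eLpNorm (G - ψ n) 2 volume + (eLpNorm (ψ n - heatExtension (ψ n) t) 2 volume +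
            eLpNorm (heatExtension (ψ n) t - heatExtension G t) 2 volume) :=
          (eLpNorm_add_le m1 (m2.add m3) (by norm_num)).trans
            (add_le_add le_rfl (eLpNorm_add_le m2 m3 (by norm_num)))
      _ ≤ eLpNorm (G - ψ n) 2 volume + (K * eLpNorm (fderiv ℝ (ψ n)) 2 volume +
            eLpNorm (G - ψ n) 2 volume) :=
          add_le_add le_rfl (add_le_add (hsmooth n) (hcontr n))
      _ ≤ eLpNorm (G - ψ n) 2 volume + (K * (eLpNorm g 2 volume +
            C * ∑ i, eLpNorm (fun x => (g - fderiv ℝ (ψ n)) x (b i)) 2 volume) +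
            eLpNorm (G - ψ n) 2 volume) := by
          gcongr
          exact hDψ_le n
      _ = _ := by ring
  -- pass to the limit
  have hlim' : Tendsto (fun n => 2 * eLpNorm (G - ψ n) 2 volume +
      K * (eLpNorm g 2 volume +
        C * ∑ i, eLpNorm (fun x => (g - fderiv ℝ (ψ n)) x (b i)) 2 volume)) atTop
      (𝓝 (2 * 0 + K * (eLpNorm g 2 volume + C * ∑ _i : Fin (Module.finrank ℝ E), (0 : ℝ≥0∞)))) := by
    refine (ENNReal.Tendsto.const_mul hlim (Or.inr ENNReal.ofNat_ne_top)).add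
      (ENNReal.Tendsto.const_mul (tendsto_const_nhds.add
        (ENNReal.Tendsto.const_mul (tendsto_finsetSum _ fun i _ => hlimD (b i))
          (Or.inr ENNReal.coe_ne_top))) (Or.inr ENNReal.ofReal_ne_top))
  simp only [mul_zero, zero_add, Finset.sum_const_zero, add_zero] at hlim'
  exact ge_of_tendsto' hlim' hmain

end Density

end Literature.Analysis.UnboundedOperators
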